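import Literature.AlgebraicGeometry.ShiodaKatsura1979.SplitHypersurfaceBlowupDominates
import Literature.AlgebraicGeometry.HodgeTheory.AlgebraicClassesPullbackHolds
import HarnessLib

/-!
# Consequences of the discharged pull-back closure (Fulton 1998 Cor. 19.2 (b)) and blow-up algebraicity
# (Arapura 2001) for split hypersurfaces (Shioda–Katsura 1979)

Family `hodge`, layer `Literature/AlgebraicGeometry/ShiodaKatsura1979`. THEOREMS ONLY: the hypothesis-free
forms of the theorems of `ShiodaKatsura1979/SplitHypersurfaceBlowupDominates` that took the named facts
`fulton1998_map_mem_algebraicClasses` / `Arapura2001_hodgeClasses_algebraic_smoothBlowup` as displayed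
hypotheses; both are PROVED in the tree (`HodgeTheory/AlgebraicClassesPullbackHolds`:
`fulton1998_map_mem_algebraicClasses_holds'`, `Arapura2001_hodgeClasses_algebraic_smoothBlowup_holds`).
Lane `lit-hodgefound`, seat p20.

## References

* [Fulton1998] W. Fulton, Intersection Theory, §19.2 Cor. 19.2 (b).
* [Arapura2001] D. Arapura, Motivation for Hodge cycles, §1.
* [ShiodaKatsura1979] T. Shioda, T. Katsura, On Fermat varieties, Tôhoku Math. J. 31 (1979).
-/

noncomputable section

open CategoryTheory AlgebraicGeometry MonoidalCategory MvPolynomial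
open Literature.AlgebraicGeometry.Motives Literature.AlgebraicGeometry.HodgeTheory

namespace Literature.AlgebraicGeometry.ShiodaKatsura1979

/-! ### From `SplitHypersurfaceBlowupDominates` -/

/-- (Hypothesis-free form of `hodgeConjectureFor_split_of_pullbackAlgebraic`: `fulton1998_map_mem_algebraicClasses` is now a Literature
theorem, `fulton1998_map_mem_algebraicClasses_holds'`.) **The same transfer granted Fulton's pull-back fact** (`fulton1998_map_mem_algebraicClasses`,
Fulton Cor. 19.2 (b) — a theorem on the Summits side of the tree), through the tree's reduction of the
smooth blow-up transfer to it (`Arapura2001_hodgeClasses_algebraic_smoothBlowup_of_pullbackAlgebraic`).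
[cite: ShiodaKatsura1979, §1 Thm. 1.7 and Remark 1.10] [cite: Arapura2001HodgeCyclesModuli, Lemma 16]
[cite: Fulton1998, §19.2 Cor. 19.2 (b)] -/
theorem hodgeConjectureFor_split_of_pullbackAlgebraic'
    {m r s : ℕ} (hSK : shiodaKatsura1979_split_smoothBlowup_surjective) (hm : 1 ≤ m) (hr : 1 ≤ r)
    (hs : 1 ≤ s) {f : MvPolynomial (Fin (r + 1)) ℂ} {g : MvPolynomial (Fin (s + 1)) ℂ}
    (hf : f.IsHomogeneous m) (hg : g.IsHomogeneous m) {B_f B_g F_f F_g X : SchemeOver ℂ}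
    (hBf : IsSmoothProjective (r - 1) B_f) (cBf : IsHypersurfaceCutOutBy r f B_f)
    (hBg : IsSmoothProjective (s - 1) B_g) (cBg : IsHypersurfaceCutOutBy s g B_g)
    (hFf : IsSmoothProjective r F_f) (cFf : IsHypersurfaceCutOutBy (r + 1) (suspension m r f) F_f)
    (hFg : IsSmoothProjective s F_g) (cFg : IsHypersurfaceCutOutBy (s + 1) (suspension m s g) F_g)
    (hX : IsSmoothProjective (r + s) X)
    (cX : IsHypersurfaceCutOutBy (r + s + 1) (splitForm r s f g) X)
    (hFF : HodgeConjectureFor (r + s) (F_f ⊗ F_g))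
    (hBB : HodgeConjectureFor ((r - 1) + (s - 1)) (B_f ⊗ B_g)) :
    HodgeConjectureFor (r + s) X :=
  hodgeConjectureFor_split_of_pullbackAlgebraic hSK fulton1998_map_mem_algebraicClasses_holds' hm hr hs hf hg hBf cBf hBg cBg hFf cFf hFg cFg hX cX hFF hBB

end Literature.AlgebraicGeometry.ShiodaKatsura1979

namespace Literature.AlgebraicGeometry.ShiodaKatsura1979

/-! ### From `SplitHypersurfaceBlowupDominates` -/

/-- (Hypothesis-free form of `hodgeConjectureFor_split_of_smoothBlowupHC`: `Arapura2001_hodgeClasses_algebraic_smoothBlowup` is now a Literature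
theorem, `Arapura2001_hodgeClasses_algebraic_smoothBlowup_holds`.) **The Hodge conjecture for `F_f × F_g` and for `B_f × B_g` implies the Hodge conjecture for the
split hypersurface `X_{f,g}`** — granted Shioda–Katsura's inductive structure and the smooth blow-up
transfer `HC(V) ∧ HC(W) ⇒ HC(Bl_W V)` (Arapura 2001 Lemma 16, the tree's named fact
`Arapura2001_hodgeClasses_algebraic_smoothBlowup`): `HC(Z)` for the blow-up `Z`, then descent along the
surjection `Z → X` between smooth projective varieties of the same dimension `r + s`
(`HodgeConjectureFor.of_surjective`). This is COROLLARY TS-HC(a) / `SplitTransferHC m r s` of the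
consumer memo. [cite: ShiodaKatsura1979, §1 Thm. 1.7 and Remark 1.10]
[cite: Arapura2001HodgeCyclesModuli, Lemma 16] [cite: vanGeemen1994HodgeAV, §3.7 Lemma 3.7] -/
theorem hodgeConjectureFor_split_of_smoothBlowupHC'
    {m r s : ℕ} (hSK : shiodaKatsura1979_split_smoothBlowup_surjective) (hm : 1 ≤ m) (hr : 1 ≤ r)
    (hs : 1 ≤ s) {f : MvPolynomial (Fin (r + 1)) ℂ} {g : MvPolynomial (Fin (s + 1)) ℂ}
    (hf : f.IsHomogeneous m) (hg : g.IsHomogeneous m) {B_f B_g F_f F_g X : SchemeOver ℂ}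
    (hBf : IsSmoothProjective (r - 1) B_f) (cBf : IsHypersurfaceCutOutBy r f B_f)
    (hBg : IsSmoothProjective (s - 1) B_g) (cBg : IsHypersurfaceCutOutBy s g B_g)
    (hFf : IsSmoothProjective r F_f) (cFf : IsHypersurfaceCutOutBy (r + 1) (suspension m r f) F_f)
    (hFg : IsSmoothProjective s F_g) (cFg : IsHypersurfaceCutOutBy (s + 1) (suspension m s g) F_g)
    (hX : IsSmoothProjective (r + s) X)
    (cX : IsHypersurfaceCutOutBy (r + s + 1) (splitForm r s f g) X)
    (hFF : HodgeConjectureFor (r + s) (F_f ⊗ F_g))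
    (hBB : HodgeConjectureFor ((r - 1) + (s - 1)) (B_f ⊗ B_g)) :
    HodgeConjectureFor (r + s) X :=
  hodgeConjectureFor_split_of_smoothBlowupHC hSK Arapura2001_hodgeClasses_algebraic_smoothBlowup_holds hm hr hs hf hg hBf cBf hBg cBg hFf cFf hFg cFg hX cX hFF hBB

end Literature.AlgebraicGeometry.ShiodaKatsura1979

end
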